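import Literature.AlgebraicTopology.Homotopy.SerreFibrationFlatFamilies
import Literature.AlgebraicTopology.Homotopy.BasepointChangeMaps
import HarnessLib

/-!
# A fibrewise map of Serre fibrations which is a weak equivalence on every fibre is a weak equivalence

Topic `Literature/AlgebraicTopology/Homotopy`. A. Hatcher, *Algebraic Topology* (2002), §4.2,
Prop. 4.66 area / Exercise 4.2.12 in the language of the long exact sequence ("a map of fibrations
inducing isomorphisms on the homotopy groups of the fibres and of the bases induces isomorphisms on
the homotopy groups of the total spaces — the five lemma"); J. P. May, *A Concise Course in
Algebraic Topology* (1999), Ch. 7 §5 (comparison of fibrations); E. H. Spanier, *Algebraic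
Topology* (1981), Ch. 7, Sec. 2, Thm. 12 / Ch. 9, Sec. 2, Thm. 17 (proof). Statement proved here:
for Serre fibrations `p : E → B`, `p' : E' → B` over the SAME base and a fibrewise map
`f : E → E'` (`p' ∘ f = p`), **if `f` restricts to a weak homotopy equivalence
`p⁻¹(b) → p'⁻¹(b)` on every fibre, then `f` is a weak homotopy equivalence**
(`IsSerreFibration.isWeakHomotopyEquiv_of_fibrewise`).

The proof avoids the five lemma: by the lifting criterion (`isWeakHomotopyEquiv_of_liftsRel`,
Hatcher p. 346) it suffices to lift cubes rel boundary through `f`; a lifting problem for the cube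
`Iⁿ → B` is a lifting problem for the pulled-back map `φ^*f : φ^*E → φ^*E'` over the cube
(`IsSerreFibration.pullback_fst`), and over the contractible cube the fibres include into the total
spaces by weak equivalences (Spanier 9.2.17, `SerreFlat.isWeakHomotopyEquiv_fibre_pullback`), so
`φ^*f` is a weak equivalence by two-out-of-three. Also proved: the two-out-of-three case
`g ∘ ι`, `ι` weak equivalences ⟹ `g` (`IsWeakHomotopyEquiv.of_comp_right`, with change of base
point along paths, Hatcher §4.1 p. 342). Everything is proved; no named fact.

## References

* A. Hatcher, *Algebraic Topology*, CUP (2002), §4.1 pp. 342, 346; §4.2 pp. 376, 405–406,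
  Prop. 4.66. [HatcherAT2002]
* E. H. Spanier, *Algebraic Topology*, Springer (1981), Ch. 7, Sec. 2, Thm. 12; Ch. 9, Sec. 2,
  Thm. 17. [Spanier1981]
-/

noncomputable section

open Set Function unitInterval
open scoped Topology unitInterval

namespace Literature.AlgebraicTopology.Homotopy

universe u v w

/-! ### Two out of three: `g ∘ ι` and `ι` weak equivalences ⟹ `g` -/

/-- **Two out of three** for weak homotopy equivalences: if `ι : X → Y` and `g ∘ ι : X → Z` are
weak homotopy equivalences then so is `g` (every point of `Y` is joined to a point `ι x`, and
bijectivity of `g_*` moves along paths). [cite: HatcherAT2002, §4.1 pp. 342, 352] -/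
theorem IsWeakHomotopyEquiv.of_comp_right {X : Type u} {Y : Type v} {Z : Type w} [TopologicalSpace X]
    [TopologicalSpace Y] [TopologicalSpace Z] (ι : C(X, Y)) (g : C(Y, Z)) (hι : IsWeakHomotopyEquiv ι)
    (hgι : IsWeakHomotopyEquiv (g.comp ι)) : IsWeakHomotopyEquiv g := by
  have h0 := hgι.1
  rw [zerothHomotopyMap_comp] at h0
  refine ⟨⟨fun a b hab => ?_, fun c => ?_⟩, fun n y => ?_⟩
  · obtain ⟨a', rfl⟩ := hι.1.2 a
    obtain ⟨b', rfl⟩ := hι.1.2 b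
    rw [h0.1 hab]
  · obtain ⟨a', ha'⟩ := h0.2 c
    exact ⟨zerothHomotopyMap ι a', ha'⟩
  · -- a point `x` with `ι x` joined to `y`
    obtain ⟨a, ha⟩ := hι.1.2 (ZerothHomotopy.mk y)
    induction a using ZerothHomotopy.rec with
    | mk x =>
      rw [zerothHomotopyMap_mk] at ha
      have hj : Joined y (ι x) := (Quotient.exact ha).symm
      refine BasepointChange.bijective_homotopyGroupMap_of_joined g hj ?_
      have h := hgι.2 n x
      rw [homotopyGroupMap_comp] at h
      have hιx := hι.2 n x
      refine ⟨fun s t hst => ?_, fun c => ?_⟩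
      · obtain ⟨s', rfl⟩ := hιx.2 s
        obtain ⟨t', rfl⟩ := hιx.2 t
        rw [h.1 hst]
      · obtain ⟨a', ha'⟩ := h.2 c
        exact ⟨homotopyGroupMap ι x a', ha'⟩

/-! ### Fibrewise maps and the maps induced on fibres -/

section Fibrewise

variable {E E' : Type u} {B : Type v} [TopologicalSpace E] [TopologicalSpace E'] [TopologicalSpace B]
  {p : E → B} {p' : E' → B}

/-- **The map on fibres** `p⁻¹(b) → p'⁻¹(b)` induced by a fibrewise map `f` (`p' ∘ f = p`).
[cite: HatcherAT2002, §4.2 p. 406] -/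
def fibreMap (f : C(E, E')) (hf : ∀ e, p' (f e) = p e) (b : B) : C(↥(p ⁻¹' {b}), ↥(p' ⁻¹' {b})) where
  toFun e := ⟨f e.1, show p' (f e.1) ∈ ({b} : Set B) by rw [hf]; exact e.2⟩
  continuous_toFun := (f.continuous.comp continuous_subtype_val).subtype_mk _

omit [TopologicalSpace B] in
/-- The fibre map on points. [folklore] -/
@[simp] theorem fibreMap_apply_coe (f : C(E, E')) (hf : ∀ e, p' (f e) = p e) (b : B) (e : ↥(p ⁻¹' {b})) :
    (fibreMap f hf b e : E') = f e := rfl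

/-- **The pulled-back map** `φ^*f : φ^*E → φ^*E'` over a parameter space `Y`. [folklore] -/
def pullbackMap {Y : Type w} [TopologicalSpace Y] (φ : C(Y, B)) (f : C(E, E')) (hf : ∀ e, p' (f e) = p e) :
    C((⇑φ).Pullback p, (⇑φ).Pullback p') where
  toFun z := ⟨(z.1.1, f z.1.2), show φ z.1.1 = p' (f z.1.2) by rw [hf]; exact z.2⟩
  continuous_toFun :=
    ((continuous_fst.comp continuous_subtype_val).prodMk
      (f.continuous.comp (continuous_snd.comp continuous_subtype_val))).subtype_mk _

/-- **Over a contractible parameter space the pulled-back map is a weak equivalence** as soon as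
`f` is a weak equivalence on the fibre over one value `φ y₀` (fibre inclusions are weak
equivalences, Spanier 9.2.17, and two-out-of-three). [cite: Spanier1981, Ch. 9, Sec. 2, Thm. 17] -/
theorem isWeakHomotopyEquiv_pullbackMap {Y : Type w} [TopologicalSpace Y] [ContractibleSpace Y]
    (hp : IsSerreFibration p) (hp' : IsSerreFibration p') (φ : C(Y, B)) (f : C(E, E'))
    (hf : ∀ e, p' (f e) = p e) (y₀ : Y) (hfib : IsWeakHomotopyEquiv (fibreMap f hf (φ y₀))) :
    IsWeakHomotopyEquiv (pullbackMap φ f hf) := by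
  -- the fibre inclusions over `y₀`
  let ι : C(↥(p ⁻¹' {φ y₀}), (⇑φ).Pullback p) :=
    ⟨fun e => ⟨(y₀, e.1), (show p e.1 = φ y₀ from e.2).symm⟩,
      (continuous_const.prodMk continuous_subtype_val).subtype_mk _⟩
  let ι' : C(↥(p' ⁻¹' {φ y₀}), (⇑φ).Pullback p') :=
    ⟨fun e => ⟨(y₀, e.1), (show p' e.1 = φ y₀ from e.2).symm⟩,
      (continuous_const.prodMk continuous_subtype_val).subtype_mk _⟩
  have hι : IsWeakHomotopyEquiv ι :=
    SerreFlat.isWeakHomotopyEquiv_fibre_pullback hp φ y₀ ι (fun _ => rfl) (fun _ => rfl)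
  have hι' : IsWeakHomotopyEquiv ι' :=
    SerreFlat.isWeakHomotopyEquiv_fibre_pullback hp' φ y₀ ι' (fun _ => rfl) (fun _ => rfl)
  have hsq : (pullbackMap φ f hf).comp ι = ι'.comp (fibreMap f hf (φ y₀)) := by
    ext e : 1; rfl
  refine IsWeakHomotopyEquiv.of_comp_right ι (pullbackMap φ f hf) hι ?_
  rw [hsq]
  exact hι'.comp hfib

/-- **A fibrewise map of Serre fibrations which is a weak homotopy equivalence on every fibre is a
weak homotopy equivalence.** Proof: lift cubes rel boundary (Hatcher p. 346); a cube in `B` pulls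
both fibrations back to the contractible cube, where the pulled-back map is a weak equivalence
(`isWeakHomotopyEquiv_pullbackMap`) and hence lifts the cube. [cite: HatcherAT2002, §4.2 p. 406 and Prop. 4.66; §4.1 p. 346]
[cite: Spanier1981, Ch. 7, Sec. 2, Thm. 12] -/
theorem IsSerreFibration.isWeakHomotopyEquiv_of_fibrewise (hp : IsSerreFibration p) (hp' : IsSerreFibration p')
    (f : C(E, E')) (hf : ∀ e, p' (f e) = p e) (hfib : ∀ b, IsWeakHomotopyEquiv (fibreMap f hf b)) :
    IsWeakHomotopyEquiv f := by
  classical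
  -- a point of `E` from a point of `E'` (fibrewise `π₀`-surjectivity)
  have hpt : ∀ e' : E', ∃ e : E, p e = p' e' := fun e' => by
    obtain ⟨a, -⟩ := (hfib (p' e')).1.2 (ZerothHomotopy.mk ⟨e', rfl⟩)
    induction a using ZerothHomotopy.rec with
    | mk e => exact ⟨e.1, e.2⟩
  rcases isEmpty_or_nonempty E with hE | hE
  · haveI : IsEmpty E' := ⟨fun e' => by obtain ⟨e, -⟩ := hpt e'; exact IsEmpty.false e⟩
    exact isWeakHomotopyEquiv_of_isEmpty f
  refine isWeakHomotopyEquiv_of_liftsRel fun N _ _ => liftsRel_cube_of_fin (fun n => ?_) N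
  intro ξ c hξ hc
  -- pull back along the cube `φ = p' ∘ c`
  let φ : C(Fin n → I, B) := ⟨fun y => p' (c y), hp'.continuous.comp c.continuous⟩
  haveI : ContractibleSpace (Fin n → I) := SerreCube.contractibleSpace_cube n
  have hF : IsWeakHomotopyEquiv (pullbackMap φ f hf) :=
    isWeakHomotopyEquiv_pullbackMap hp hp' φ f hf (fun _ => 0) (hfib _)
  have hFl : CubeLift.LiftsRel (pullbackMap φ f hf) (Fin n → I) (Cube.boundary (Fin n)) := by
    cases n with
    | zero => exact hF.liftsRel_cube_zero
    | succ k => exact hF.liftsRel_cube_succ k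
  -- the lifting data in the pullbacks
  obtain ⟨e₀, he₀⟩ := hpt (c fun _ => 0)
  let z₀ : (⇑φ).Pullback p := ⟨(fun _ => 0, e₀), he₀.symm⟩
  let ξP : (Fin n → I) → (⇑φ).Pullback p := fun y =>
    if h : φ y = p (ξ y) then ⟨(y, ξ y), h⟩ else z₀
  have hξP : ∀ y (hy : y ∈ Cube.boundary (Fin n)), ξP y = ⟨(y, ξ y), by
      show p' (c y) = p (ξ y)
      rw [hc y hy, hf]⟩ := fun y hy => by
    have h : φ y = p (ξ y) := by show p' (c y) = p (ξ y); rw [hc y hy, hf]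
    simp only [ξP, dif_pos h]
  have hξPc : ContinuousOn ξP (Cube.boundary (Fin n)) := by
    rw [continuousOn_iff_continuous_restrict]
    have heq : (Cube.boundary (Fin n)).restrict ξP = fun y : ↥(Cube.boundary (Fin n)) =>
        (⟨((y : Fin n → I), ξ y), by show p' (c y) = p (ξ y); rw [hc y y.2, hf]⟩ : (⇑φ).Pullback p) := by
      funext y
      exact hξP y y.2
    rw [heq]
    refine Continuous.subtype_mk (continuous_subtype_val.prodMk ?_) _
    exact continuousOn_iff_continuous_restrict.1 hξ
  let cP : C(Fin n → I, (⇑φ).Pullback p') :=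
    ⟨fun y => ⟨(y, c y), rfl⟩, (continuous_id.prodMk c.continuous).subtype_mk _⟩
  have hcP : ∀ y ∈ Cube.boundary (Fin n), cP y = pullbackMap φ f hf (ξP y) := fun y hy => by
    rw [hξP y hy]
    apply Subtype.ext
    show ((y, c y) : (Fin n → I) × E') = (y, f (ξ y))
    rw [hc y hy]
  obtain ⟨Ξ, hΞ, hhom⟩ := hFl ξP cP hξPc hcP
  -- back to `E`
  let snd' : C((⇑φ).Pullback p', E') := ⟨Function.Pullback.snd, continuous_snd.comp continuous_subtype_val⟩
  let sndP : C((⇑φ).Pullback p, E) := ⟨Function.Pullback.snd, continuous_snd.comp continuous_subtype_val⟩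
  refine ⟨sndP.comp Ξ, fun y hy => ?_, ?_⟩
  · show (Ξ y).snd = ξ y
    rw [hΞ y hy, hξP y hy]
    rfl
  · have h1 : f.comp (sndP.comp Ξ) = snd'.comp ((pullbackMap φ f hf).comp Ξ) := by ext y : 1; rfl
    have h2 : c = snd'.comp cP := by ext y : 1; rfl
    rw [h1, h2]
    exact hhom.comp_continuousMap snd'

/-- Variant with the fibre hypothesis stated on the fibres `p⁻¹(p e)` through the points of `E` and
the fibres over points of `E'` (all fibres that matter). [cite: HatcherAT2002, §4.2 p. 406 and Prop. 4.66] -/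
theorem IsSerreFibration.isWeakHomotopyEquiv_of_fibrewise' (hp : IsSerreFibration p) (hp' : IsSerreFibration p')
    (f : C(E, E')) (hf : ∀ e, p' (f e) = p e)
    (hfib : ∀ b ∈ range p', IsWeakHomotopyEquiv (fibreMap f hf b)) : IsWeakHomotopyEquiv f := by
  refine hp.isWeakHomotopyEquiv_of_fibrewise hp' f hf fun b => ?_
  by_cases hb : b ∈ range p'
  · exact hfib b hb
  · -- both fibres are empty
    haveI : IsEmpty ↥(p' ⁻¹' {b}) := ⟨fun e => hb ⟨e.1, e.2⟩⟩
    haveI : IsEmpty ↥(p ⁻¹' {b}) := ⟨fun e => hb ⟨f e.1, by rw [hf]; exact e.2⟩⟩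
    exact isWeakHomotopyEquiv_of_isEmpty _

end Fibrewise

end Literature.AlgebraicTopology.Homotopy
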